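import Summits.NavierStokesRegularity.NavierStokesRegularity.Theses.ExtremalTypeIConstant
import Summits.NavierStokesRegularity.NavierStokesRegularity.Theorems.SymmetryModuliCountSymmetricLiouvilleCore
import HarnessLib

/-!
# Route `ExtremalTypeIConstant`, crux `SpiralScalingLiouville` (stmt-NavierStokesRegularity-8216):
# the crux is EQUIVALENT to the sibling crux `SymmetricLiouville` (stmt-4053) and to the open
# rotated-self-similar core, and follows BY NAME from the conjecture leaf `TypeIDSSLiouvilleConjecture`

Summits-side theorem file (kind = proof, no definitions) of line `registered` (birth skeleton) of the crux
`SpiralScalingLiouville`: an element `u` of the Type-I KNSS-mild ancient class `A_C` (`IsTypeIAncientMild C u`)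
annihilated on `t < 0` by a spiral-scaling generator `∇u·(a + x + Ax) + u + 2t∂ₜu − Au`, `A` skew, vanishes.

* `rotatedSelfSimilarLiouville_of_spiralScalingLiouville` — the crux contains the bounded-profile
  rotated-self-similar Liouville statement of route `SymmetryModuliCount` (take `a = 0`);
* `spiralScalingLiouville_of_symmetricLiouville` — the crux is the case `σ = 1` of `SymmetricLiouville`;
* `spiralScalingLiouville_iff_symmetricLiouville` — hence, with the tree theorem `symmetricLiouville_iff_core`
  (line `blowdown-kills-pitch` of stmt-4053: periodic leaf, `AxisymEndLiouville_of`, far-field recentring), the two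
  cruxes are EQUIVALENT statements;
* `spiralScalingLiouville_iff_rssCoreTypeI` — and (Oseen bootstrap B2, `core_iff_coreTypeI`) the crux is equivalent to
  RSS Liouville for elements of `A_C` in Pineau–Vicol's decay class `‖u(t,x)‖ ≤ K/(‖x‖ + √(−t))` with `A ≠ 0`
  (Pineau–Vicol Conj. 1.1 / Tsai GSM 192 Conj. 8.9 inside the gauge class; known off the window `α ≈ 1` by
  Pineau–Vicol Thm 1.4);
* `spiralScalingLiouville_of_typeIDSSLiouvilleConjecture` — the crux BY NAME from the canonical conjecture leaf
  `Summit.NavierStokesRegularity.NavierStokesRegularity.TypeIDSSLiouvilleConjecture` (Bradshaw–Tsai OP 5.1, rotated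
  half), via `symmetricLiouville_of_typeIDSSLiouvilleConjecture`. CONDITIONAL result (the item stays open on the
  conjecture).

References: Pineau–Vicol arXiv:2607.09619 Conj. 1.1, Thm 1.4; Tsai, ARMA 143 (1998) Thm 1; Bradshaw–Tsai, CPDE 42
(2017) §5 OP 5.1–5.2; Koch–Nadirashvili–Seregin–Šverák, Acta Math. 203 (2009) = arXiv:0709.3599 §1, §6.
-/

noncomputable section

set_option linter.dupNamespace false

open Set Function
open Literature.Analysis.FluidPDE
open Summit.NavierStokesRegularity.NavierStokesRegularity.Theses.SymmetryModuliCount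
open Summit.NavierStokesRegularity.NavierStokesRegularity.Theses.ExtremalTypeIConstant
open Summit.NavierStokesRegularity.NavierStokesRegularity.Theorems.SymmetryModuliCountSymmetricLiouville

namespace Summit.NavierStokesRegularity.NavierStokesRegularity.Theorems

/-- **The crux contains the bounded-profile rotated-self-similar Liouville statement** (any skew rate `A`,
`A = 0` allowed): an element of `A_C` annihilated by the generator in normal form `∇u·(x + Ax) + u + 2t∂ₜu − Au`
vanishes — the case `a = 0` of `SpiralScalingLiouville`. [cite: PineauVicol2026, Conjecture 1.1 (arXiv:2607.09619 p. 3)] -/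
theorem rotatedSelfSimilarLiouville_of_spiralScalingLiouville (h : SpiralScalingLiouville) :
    ∀ (C : ℝ) (u : ℝ → EuclideanSpace ℝ (Fin 3) → EuclideanSpace ℝ (Fin 3)), IsTypeIAncientMild C u →
      ∀ A : EuclideanSpace ℝ (Fin 3) →L[ℝ] EuclideanSpace ℝ (Fin 3), (∀ x, inner ℝ (A x) x = 0) →
        (∀ t < 0, ∀ x, fderiv ℝ (u t) x (x + A x) + u t x + (2 * t) • timeDeriv u t x - A (u t x) = 0) →
        ∀ t < 0, ∀ x, u t x = 0 := by
  intro C u hcl A hA hL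
  refine h C u (isTypeIAncientMild_iff.1 hcl) ⟨0, A, hA, ?_⟩
  intro t ht x
  simpa only [zero_add] using hL t ht x

/-- **The crux is the case `σ = 1` of the sibling crux `SymmetricLiouville`** (stmt-NavierStokesRegularity-4053,
route `SymmetryModuliCount`): the generator `∇u·(a + σx + Ax) + σu + 2σt∂ₜu − Au` at `σ = 1` is the spiral-scaling
generator, and `(a, 1, A) ≠ 0`. [cite: KochNadirashviliSereginSverak2009, §1 p. 3 (arXiv:0709.3599)] -/
theorem spiralScalingLiouville_of_symmetricLiouville (h : SymmetricLiouville) : SpiralScalingLiouville := by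
  intro C u hu hsym t ht x
  obtain ⟨a, A, hA, hL⟩ := hsym
  refine h C u hu a 1 A hA (fun hz => one_ne_zero hz.2.1) ?_ t ht x
  intro s hs y
  simpa only [one_smul, mul_one] using hL s hs y

/-- **The cruxes `SpiralScalingLiouville` (stmt-8216) and `SymmetricLiouville` (stmt-4053) are EQUIVALENT**:
`←` is the specialisation `σ = 1`; `→` feeds the bounded-profile RSS Liouville statement contained in the crux into
the tree's reduction `symmetricLiouville_iff_core` (periodic leaf, `AxisymEndLiouville_of`, far-field recentring —
all landed for stmt-4053). [cite: PineauVicol2026, Conjecture 1.1 (arXiv:2607.09619 p. 3)] -/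
theorem spiralScalingLiouville_iff_symmetricLiouville : SpiralScalingLiouville ↔ SymmetricLiouville := by
  refine ⟨fun h => symmetricLiouville_iff_core.2 ?_, spiralScalingLiouville_of_symmetricLiouville⟩
  intro C u hcl A hA _ hL _
  exact rotatedSelfSimilarLiouville_of_spiralScalingLiouville h C u hcl A hA hL

/-- **The crux is equivalent to RSS Liouville in Pineau–Vicol's class inside `A_C`**: elements of `A_C` with a
rotated-self-similar symmetry of nonzero skew rate `A` and the space–time Type-I bound
`‖u(t,x)‖ ≤ K/(‖x‖ + √(−t))` (`HasTypeIDecay`, Pineau–Vicol (1.10)) vanish — Pineau–Vicol Conj. 1.1 / Tsai GSM 192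
Conj. 8.9 in the gauge class (the window `α ≈ 1` is open; the extremes are `pineauVicol2026_rss_liouville_holds`).
By `spiralScalingLiouville_iff_symmetricLiouville`, `symmetricLiouville_iff_core` and the Oseen bootstrap
`core_iff_coreTypeI`. [cite: PineauVicol2026, Conjecture 1.1 and Theorem 1.4 (arXiv:2607.09619 pp. 3–4)] -/
theorem spiralScalingLiouville_iff_rssCoreTypeI :
    SpiralScalingLiouville ↔
      ∀ (C : ℝ) (u : ℝ → EuclideanSpace ℝ (Fin 3) → EuclideanSpace ℝ (Fin 3)), IsTypeIAncientMild C u →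
        ∀ A : EuclideanSpace ℝ (Fin 3) →L[ℝ] EuclideanSpace ℝ (Fin 3), (∀ x, inner ℝ (A x) x = 0) → A ≠ 0 →
          (∀ t < 0, ∀ x, fderiv ℝ (u t) x (x + A x) + u t x + (2 * t) • timeDeriv u t x - A (u t x) = 0) →
          (∃ K : ℝ, HasTypeIDecay K u) → ∀ t < 0, ∀ x, u t x = 0 :=
  spiralScalingLiouville_iff_symmetricLiouville.trans (symmetricLiouville_iff_core.trans core_iff_coreTypeI)

/-- **The crux `SpiralScalingLiouville` (stmt-NavierStokesRegularity-8216) BY NAME from the canonical conjecture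
leaf `TypeIDSSLiouvilleConjecture`** (Bradshaw–Tsai OP 5.1 / Tsai GSM 192 Conj. 8.8–8.9, rotated half): the tree's
`symmetricLiouville_of_typeIDSSLiouvilleConjecture` followed by the specialisation `σ = 1`. CONDITIONAL on the
conjecture (the item stays open on it). [cite: BradshawTsai2017CPDE, §5 Open Problem 5.1] -/
theorem spiralScalingLiouville_of_typeIDSSLiouvilleConjecture
    (hConj : _root_.Summit.NavierStokesRegularity.NavierStokesRegularity.TypeIDSSLiouvilleConjecture) :
    SpiralScalingLiouville :=
  spiralScalingLiouville_of_symmetricLiouville (symmetricLiouville_of_typeIDSSLiouvilleConjecture hConj)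

end Summit.NavierStokesRegularity.NavierStokesRegularity.Theorems

end
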